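import Mathlib
import HarnessLib
import Literature.MathematicalPhysics.StatisticalMechanics.TorusFRDStepKernelPair
import Literature.MathematicalPhysics.StatisticalMechanics.LinearisedMapABKMKernelSub
import Literature.MathematicalPhysics.StatisticalMechanics.RGStepABKM

/-!
# `‖C_k^{(q')}K − C_k^{(q)}K‖_{k+1}^{(A)} ≤ ℓ_N(q,q')·(L^d κ c + ε)·‖K‖_k^{(A)}` for the step kernels of ONE
# `TorusFRD` package, `q, q'` small symmetric ([ABKM19] Lemma 10.1 two-kernel form; Lemma 12.6 (12.53), linear part)

The part of `S_{q'}(H,K) − S_q(H,K)` that is linear in `K` is `(C_k^{(q')} − C_k^{(q)})K`; its norm bound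
for the torus data (`LinearisedMapABKMKernelSub.weakNormLE_opC_sub_abkm_of_stepKernelBounds`) needs
`StepKernelBounds` for both kernels and the `ℓ = 1` integration property of the pair — supplied here
from one `TorusFRD` package exactly as in `StepOperatorBLipschitzTorusFRD` (`TorusFRDStepKernelPair`
∘ `FluctuationKernelComparisonProperty.tayNormLE_fluct_sub_fluct_pow_abkm`):

* **`weakNormLE_opC_sub_of_torusFRD`** — for symmetric `q, q'` with `Σ|q_{ij}|, Σ|q'_{ij}| ≤ T₀ ≤ ½`,
  `K T₀ ≤ log(1+ρ)` (`ρ < θ̄`), Hölder `p, q_H` with `p(1+ρ) ≤ 1+ρ''` (`ρ'' < θ̄`), `τ ≥ 0` with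
  `K·Σ|q'−q| ≤ log(1+τ)`, `τ(1+τ) ≤ 1/(16 q_H)`, large-set parameter `A ≥ κ := A𝒫(ρ'')^{1/p}` with the
  smallness/gain conditions at `κ`, and a translation-invariant local `C^{r₀}` activity `K` with
  `‖K‖_k^{(A)} ≤ C` and `C^{r₀}` fluctuation integrals under both kernels:
  `‖opC (abkmStepData L R k 𝒞s_{q'}) K − opC (abkmStepData L R k 𝒞s_q) K‖_{k+1}^{(A)}
     ≤ C · (L^d · ℓκ · abkmContrConst d L R + ℓ · largePartEps d L A κ η)`, `ℓ = (r₀+1)·gaussCompConst(|Λ|,q_H)·τ(1+τ)`.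

Everything is proved; no named fact.

## References
* S. Adams, S. Buchholz, R. Kotecký, S. Müller, arXiv:1910.13564, Lemma 10.1, Lemma 12.6 (12.53)
  [AdamsBuchholzKoteckyMuller2019].
-/

noncomputable section

namespace Literature.MathematicalPhysics.StatisticalMechanics.GradientRG

open scoped BigOperators
open Real Set Finset MeasureTheory
open Literature.MathematicalPhysics.StatisticalMechanics.GradientFRD
  (fourierCoeff cExt cExt_of_mem IsElliptic IsUnitSymm InShell iterDiff supNorm conv ellOp isElliptic_one
    exists_inShell re_fourierCoeff_zero_of_sum_eq_zero)
open Literature.MathematicalPhysics.StatisticalMechanics.TorusPolymer (IsPolymer numBlocks blocks blockOf boxCorner closure)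
open Literature.Barriers.CriticalPhenomena.LongRangePhi4.Polymer (IsConn)
open Literature.MathematicalPhysics.QuantumFieldTheory

variable {d M : ℕ} [NeZero M]

section Package

variable {L N Mord R n ñ : ℕ} {θbar lam μ δ₁ δ₀ A𝒫 : ℝ}
    {𝒞 : Matrix (Fin d) (Fin d) ℝ → ℕ → (Fin d → ZMod M) → ℝ} {Mc : ℕ → ℝ}
    {Cα : (Fin d → ℕ) → ℕ → ℝ} {c C : ℝ} {Cℓ : ℕ → ℝ}

/-- **The linear part of hypothesis (12.53) of [ABKM19] Lemma 12.6, torus data, at the level of the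
tuning parameters** (module docstring). [cite: AdamsBuchholzKoteckyMuller2019, Lemma 12.6 (12.53) / Lemma 10.1] -/
theorem weakNormLE_opC_sub_of_torusFRD
    (hd : 3 ≤ d) (hMord : 1 ≤ Mord) (hMR : Mord ≤ R) (hLodd : Odd L) (hL : 2 ^ (d + 3) + 16 * R ≤ L)
    (hM : M = L ^ N)
    (hθbar : 0 < θbar) (hlam : 0 < lam) (hn : 2 * Mord ≤ n) (hn2 : 2 ≤ n) (hnñ : n ≤ ñ)
    (hc : 0 < c) (hC1 : 0 ≤ Cℓ 1)
    (hallA : ∀ A : Matrix (Fin d) (Fin d) ℝ, IsElliptic (1 / 2 : ℝ) 2 A →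
        (∀ k, 1 ≤ k → k ≤ N + 1 →
          ∑ x : Fin d → ZMod M, 𝒞 A k x = 0 ∧ ∀ x, 𝒞 A k (-x) = 𝒞 A k x) ∧
        (∀ k, 1 ≤ k → k ≤ N + 1 → ∀ φ : (Fin d → ZMod M) → ℝ, ∑ x, φ x = 0 →
          0 ≤ ∑ x, ∑ y, φ x * 𝒞 A k (x - y) * φ y) ∧
        (∀ φ : (Fin d → ZMod M) → ℝ, ∑ x, φ x = 0 →
          ellOp A (conv (fun x => ∑ k ∈ Finset.Icc 1 (N + 1), 𝒞 A k x) φ) = φ) ∧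
        (∀ k, 1 ≤ k → k ≤ N → Mc k ≤ 0 ∧
          ∀ x : Fin d → ZMod M, ((L : ℝ) ^ k) / 2 ≤ (supNorm x : ℝ) →
            𝒞 A k x = Mc k) ∧
        (∀ k, 1 ≤ k → k ≤ N + 1 → ∀ B : Matrix (Fin d) (Fin d) ℝ, IsUnitSymm B →
          (∃ ε : ℝ, 0 < ε ∧ ∀ x : Fin d → ZMod M,
            ContDiffOn ℝ ⊤ (fun s : ℝ => 𝒞 (A + s • B) k x) (Set.Ioo (-ε) ε)) ∧
          ∀ α : Fin d → ℕ, ∑ i, α i ≤ n → ∀ ℓ : ℕ, ∀ x : Fin d → ZMod M,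
            abs (iteratedDeriv ℓ (fun s : ℝ => iterDiff α (𝒞 (A + s • B) k) x) 0)
              ≤ Cα α ℓ / (L : ℝ) ^ ((k - 1) * (d - 2 + ∑ i, α i))) ∧
        (∀ k, 1 ≤ k → k ≤ N + 1 → ∀ j : ℕ, ∀ κ : Fin d → ZMod M, κ ≠ 0 → InShell L j κ →
          (j < k →
            c / (L : ℝ) ^ (2 * (d + ñ) + 1) * (L : ℝ) ^ (2 * j)
                / (L : ℝ) ^ ((k - j) * (d - 1 + n)) ≤ (fourierCoeff (𝒞 A k) κ).re ∧
            ‖fourierCoeff (𝒞 A k) κ‖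
              ≤ C * (L : ℝ) ^ (2 * (d + ñ) + 1) * (L : ℝ) ^ (2 * j)
                  / (L : ℝ) ^ ((k - j) * (d - 1 + n))) ∧
          (k ≤ j →
            c / (L : ℝ) ^ (2 * (d + ñ) + 1) * (L : ℝ) ^ (2 * k)
                ≤ (fourierCoeff (𝒞 A k) κ).re ∧
            ‖fourierCoeff (𝒞 A k) κ‖ ≤ C * (L : ℝ) ^ (2 * k)) ∧
          ∀ B : Matrix (Fin d) (Fin d) ℝ, IsUnitSymm B → ∀ ℓ : ℕ, 1 ≤ ℓ →
            (j < k →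
              ‖iteratedDeriv ℓ (fun s : ℝ => fourierCoeff (𝒞 (A + s • B) k) κ) 0‖
                ≤ Cℓ ℓ * (L : ℝ) ^ (2 * (d + ñ) + 1) * (L : ℝ) ^ (2 * j)
                    / (L : ℝ) ^ ((k - j) * (d - 1 + ñ))) ∧
            (k ≤ j →
              ‖iteratedDeriv ℓ (fun s : ℝ => fourierCoeff (𝒞 (A + s • B) k) κ) 0‖
                ≤ Cℓ ℓ * (L : ℝ) ^ (2 * k))))
    (hB : AbkmWeightBounds L N Mord R n θbar lam μ δ₁ δ₀ A𝒫 (fun j => 𝒞 1 j)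
      (abkmWeightData L N Mord R θbar (schedDelta δ₀ δ₁ N) fun j => 𝒞 1 j))
    {k : ℕ} (hkN : k + 1 ≤ N) {pT r₀ : ℕ} (hpT : d / 2 + 2 ≤ pT) (hpM : pT + d ≤ Mord) (hr₀ : 3 ≤ r₀)
    {h A : ℝ} (hδ₀ : 0 < δ₀) (hδ₁ : 0 < δ₁) (hh : 0 < h) (hh0 : hZeroSq d R δ₀ δ₁ ≤ h ^ 2)
    (hA : 1 ≤ A) {ρ : ℝ} (hρ0 : 0 ≤ ρ) (hρ : ρ < θbar)
    {T₀ : ℝ} (hT₀ : T₀ ≤ 1 / 2) (hKT₀ : shellRatioConst c (Cℓ 1) (L : ℝ) d ñ * T₀ ≤ Real.log (1 + ρ))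
    {q q' : Matrix (Fin d) (Fin d) ℝ} (hq : q.IsSymm) (hq' : q'.IsSymm)
    (hqT : ∑ i, ∑ j, |q i j| ≤ T₀) (hq'T : ∑ i, ∑ j, |q' i j| ≤ T₀)
    {p qH ρ'' : ℝ} (hpq : p.HolderConjugate qH) (hρ''0 : 0 ≤ ρ'') (hρ'' : ρ'' < θbar)
    (hpρ : p * (1 + ρ) ≤ 1 + ρ'')
    {τ : ℝ} (hτ : 0 ≤ τ)
    (hKT : shellRatioConst c (Cℓ 1) (L : ℝ) d ñ * ∑ i, ∑ j, |(q' - q) i j| ≤ Real.log (1 + τ))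
    (hτq : τ * (1 + τ) ≤ 1 / (16 * qH))
    -- large-set parameter at `κ = A𝒫(ρ'')^{1/p}`
    (hκA : weightIntConstRho θbar ρ'' (traceConst d Mord R lam (derivSum d n fun θ' _ => Cα θ' 0)) ^ (1 / p) ≤ A)
    {η : ℝ} (hη : 0 < η)
    (hsmall : (2 : ℝ) ^ (L ^ d) *
      (weightIntConstRho θbar ρ'' (traceConst d Mord R lam (derivSum d n fun θ' _ => Cα θ' 0)) ^ (1 / p) *
        A ^ (-(1 - η⁻¹) : ℝ)) ≤ 1)
    (hgain : ∀ X : Finset (Fin d → ZMod M), IsPolymer (L ^ k) X → IsConn X →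
      2 ^ d < (blocks (L ^ k) X).card →
        η * ((blocks (L * L ^ k) (closure (L * L ^ k) X)).card : ℝ) ≤ (blocks (L ^ k) X).card)
    {K : Finset (Fin d → ZMod M) → ((Fin d → ZMod M) → ℝ) → ℂ} {C : ℝ} (hC : 0 ≤ C)
    (hK : WeakNormLE (abkmNormParams L N Mord R pT r₀ h θbar A (schedDelta δ₀ δ₁ N) fun j => 𝒞 1 j) k K C)
    (hKt : TransInv (L ^ k) K) (hKd : ∀ X, ContDiff ℝ r₀ (K X))
    (hKloc : ∀ X, IsPolymer (L ^ k) X → IsConn X →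
      IsGaugeLocal ((abkmNormParams L N Mord R pT r₀ h θbar A (schedDelta δ₀ δ₁ N) fun j => 𝒞 1 j).gauge k X)
        (K X))
    (hRa : ∀ X, ContDiff ℝ r₀ (fluct (𝒞 ((1 : Matrix (Fin d) (Fin d) ℝ) + q') (k + 1)) (K X)))
    (hRb : ∀ X, ContDiff ℝ r₀ (fluct (𝒞 ((1 : Matrix (Fin d) (Fin d) ℝ) + q) (k + 1)) (K X))) :
    WeakNormLE (abkmNormParams L N Mord R pT r₀ h θbar A (schedDelta δ₀ δ₁ N) fun j => 𝒞 1 j) (k + 1)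
      (opC (abkmStepData L R k fun j => 𝒞 ((1 : Matrix (Fin d) (Fin d) ℝ) + q') j) K -
        opC (abkmStepData L R k fun j => 𝒞 ((1 : Matrix (Fin d) (Fin d) ℝ) + q) j) K)
      (C * ((L : ℝ) ^ d *
        ((((r₀ + 1) * gaussCompConst (Fintype.card (Fin d → ZMod M)) qH * (τ * (1 + τ))) *
          weightIntConstRho θbar ρ'' (traceConst d Mord R lam (derivSum d n fun θ' _ => Cα θ' 0)) ^ (1 / p)) *
            abkmContrConst d L R) +
        ((r₀ + 1) * gaussCompConst (Fintype.card (Fin d → ZMod M)) qH * (τ * (1 + τ))) *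
          largePartEps d L A
            (weightIntConstRho θbar ρ'' (traceConst d Mord R lam (derivSum d n fun θ' _ => Cα θ' 0)) ^ (1 / p)) η)) := by
  have h8 : 8 ≤ 2 ^ (d + 3) := by
    calc 8 = 2 ^ 3 := by norm_num
      _ ≤ 2 ^ (d + 3) := Nat.pow_le_pow_right (by norm_num) (by omega)
  have hL2 : 2 ≤ L := by omega
  have hk : k + 1 ≤ N + 1 := by omega
  have hp0 : 0 ≤ p := by linarith [hpq.lt]
  have hq2 : ∑ i, ∑ j, |q i j| ≤ 1 / 2 := hqT.trans hT₀
  have hq'2 : ∑ i, ∑ j, |q' i j| ≤ 1 / 2 := hq'T.trans hT₀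
  have hellq : IsElliptic (1 / 2 : ℝ) 2 ((1 : Matrix (Fin d) (Fin d) ℝ) + q) :=
    isElliptic_one_add_of_entrySum_le hq hq2
  have hellq' : IsElliptic (1 / 2 : ℝ) 2 ((1 : Matrix (Fin d) (Fin d) ℝ) + q') :=
    isElliptic_one_add_of_entrySum_le hq' hq'2
  set Da := abkmStepData L R k fun j => 𝒞 ((1 : Matrix (Fin d) (Fin d) ℝ) + q') j with hDa
  set Db := abkmStepData L R k fun j => 𝒞 ((1 : Matrix (Fin d) (Fin d) ℝ) + q) j with hDb
  have hDa𝒞 : Da.𝒞 = 𝒞 ((1 : Matrix (Fin d) (Fin d) ℝ) + q') (k + 1) := rfl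
  have hDb𝒞 : Db.𝒞 = 𝒞 ((1 : Matrix (Fin d) (Fin d) ℝ) + q) (k + 1) := rfl
  have hSa : StepKernelBounds (abkmWeightData L N Mord R θbar (schedDelta δ₀ δ₁ N) fun j => 𝒞 1 j) L k _ _ Da.𝒞 :=
    stepKernelBounds_one_add_of_torusFRD hd hMord hMR hLodd hL hθbar hlam hn hn2 hnñ hc hC1 hallA hB hk
      hρ0 hρ hT₀ hKT₀ hq' hq'T
  have hSb : StepKernelBounds (abkmWeightData L N Mord R θbar (schedDelta δ₀ δ₁ N) fun j => 𝒞 1 j) L k _ _ Db.𝒞 :=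
    stepKernelBounds_one_add_of_torusFRD hd hMord hMR hLodd hL hθbar hlam hn hn2 hnñ hc hC1 hallA hB hk
      hρ0 hρ hT₀ hKT₀ hq hqT
  have hSp : StepKernelBounds (abkmWeightData L N Mord R θbar (schedDelta δ₀ δ₁ N) fun j => 𝒞 1 j) L k _ _
      (fun x => p * Db.𝒞 x) :=
    stepKernelBounds_const_mul_one_add_of_torusFRD hd hMord hMR hLodd hL hθbar hlam hn hn2 hnñ hc hC1
      hallA hB hk hρ0 hT₀ hKT₀ hq hqT hp0 hρ''0 hρ'' hpρ
  have hA𝒫p : 0 ≤ weightIntConstRho θbar ρ'' (traceConst d Mord R lam (derivSum d n fun θ' _ => Cα θ' 0)) :=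
    zero_le_one.trans (one_le_weightIntConstRho hθbar hρ''0 hρ''
      (traceConst_nonneg d Mord R hlam.le (derivSum_nonneg d n _)))
  have hoa := (hallA _ hellq').1 (k + 1) (by omega) hk
  have hob := (hallA _ hellq).1 (k + 1) (by omega) hk
  have hposa : ∀ κ : Fin d → ZMod M, κ ≠ 0 → 0 < (fourierCoeff Da.𝒞 κ).re := fun κ hκ =>
    re_fourierCoeff_pos_of_torusFRD (hallA _ hellq').2.2.2.2.2 hc hL2 (by omega) hk hκ
  have hposb : ∀ κ : Fin d → ZMod M, κ ≠ 0 → 0 < (fourierCoeff Db.𝒞 κ).re := fun κ hκ =>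
    re_fourierCoeff_pos_of_torusFRD (hallA _ hellq).2.2.2.2.2 hc hL2 (by omega) hk hκ
  have hcmp : ∀ κ, |(fourierCoeff Da.𝒞 κ).re - (fourierCoeff Db.𝒞 κ).re| ≤ τ * (1 + τ) * (fourierCoeff Da.𝒞 κ).re :=
    abs_re_fourierCoeff_one_add_sub_le_of_torusFRD (fun A hA => (hallA A hA).1)
      (fun A hA => (hallA A hA).2.2.2.2.1) (fun A hA => (hallA A hA).2.2.2.2.2) hc hC1 hL2 hnñ hq hq' hq2 hq'2
      (k := k + 1) (by omega) hk hτ hKT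
  have hq0 : 0 < qH := by linarith [hpq.symm.lt]
  have hℓ : 0 ≤ (r₀ + 1) * gaussCompConst (Fintype.card (Fin d → ZMod M)) qH * (τ * (1 + τ)) := by
    have := gaussCompConst_nonneg (Fintype.card (Fin d → ZMod M)) hq0.le
    positivity
  have hκ0 : 0 ≤ weightIntConstRho θbar ρ'' (traceConst d Mord R lam (derivSum d n fun θ' _ => Cα θ' 0)) ^ (1 / p) :=
    Real.rpow_nonneg hA𝒫p _
  exact weakNormLE_opC_sub_abkm_of_stepKernelBounds hd hLodd hL hM hkN hpT hpM hMR hr₀ hB hδ₀ hδ₁ hh hh0 hκ0 hA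
    hκA hη hsmall hgain Da Db rfl rfl hSa hSb rfl rfl rfl rfl (x₀ := 0) rfl rfl hℓ
    (fun X hX _ F b hb hFd hFloc hF =>
      tayNormLE_fluct_sub_fluct_pow_abkm hB hSa hSb hpq hSp hA𝒫p hoa.2 hob.2 hoa.1 hob.1 hposa hposb
        (δ := τ * (1 + τ)) (by positivity) hτq hcmp hX hb hFd hFloc hF)
    hC hK hKt hKd hKloc hRa hRb

end Package

end Literature.MathematicalPhysics.StatisticalMechanics.GradientRG

end
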